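import Summits.CriticalPhenomena.PercolationContinuityZ3.Theorems.Transplant.SkelFrmFrom1Serve
import Summits.CriticalPhenomena.PercolationContinuityZ3.Theorems.Transplant.PlanarSkeletonFrmQuasiDefs
import Summits.CriticalPhenomena.PercolationContinuityZ3.Theorems.Transplant.SkelFrmQuasi1ChoiceDefs
import HarnessLib

/-!
# GEN-Q PORT (WAVE-Q table v0.8 section 2, row G259, U-level ?; captain R-6/R-7 2026-08-27: carrier token swap `PlanarSkeletonFrmFrom ↦ PlanarSkeletonFrmQuasi`)
# of the tree module «Transplant/SkelFrmFrom1ServeAt» (sha256 d4da6e6f7397bfe8…) onto the quasi-step carrier `PlanarSkeletonFrmQuasi` (p507026): «SkelFrmQuasi1ServeAt»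

ORIGINAL TITLE: 

builds on p205010 (kernel theorem, internal audit signed; external expert review pending) — nothing in this file uses p205010; NOTHING is claimed about any open node
((N3-b), the end state).  Lane `prim-bschramm`, seat `prim-bschramm-gen-1` (gen 4; binder-wave captain).  Helper file (`--supports stmt-CriticalPhenomena-4575 --as helper`).
PORT RULES (U-wave r1–r4 re-used, GEN-Q hunk classes of p3-g29 #6136): declaration order, names and proof texts are those of «SkelFrmFrom1ServeAt», byte-identical except
(i) the carrier token `PlanarSkeletonFrmFrom ↦ PlanarSkeletonFrmQuasi` in binders, `namespace`/`end` lines and qualified names (module names `SkelFrmFrom… ↦ SkelFrmQuasi…`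
in imports of already-ported rows); (ii) `Φ.step ↦ Φ.qstep` with the called Steps lemma replaced by its `…Q`/`_q` twin and the cost `Φ.M` threaded (none in this file unless
listed below); (iii) `Φ.cyl_connected ↦ Φ.cyl_reach` readers (none unless listed); (iv) graph-ball radii / window floors ×`Φ.M` (none unless listed).  Carrier-free
residents stay imported/exported from the original «SkelFrm1ServeAt» exactly as in the FrmFrom port.  Docstrings and citations are the original's.

-/

noncomputable section

open scoped Classical

namespace Summit.CriticalPhenomena.PercolationContinuityZ3.Theorems.Transplant

open MeasureTheory Literature.Probability.Percolation Literature.Probability.LatticeModels SimpleGraph KNCells KNLevels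

namespace PlanarSkeletonFrmQuasi

open SkelConc (Consts)
open Skelφ (oriφ trφ)
open Skelφ.StepI (DataN OutNS eventNAt)

variable {V : Type} [Countable V] {G : SimpleGraph V} [G.LocallyFinite]

namespace ChoiceNQ

/-- **The listed pairs' served piece-links AT A FRAME-IMAGE CENTRE** (`(M, n) ∈ 𝒞.SMn O`; the centre `c = α t` for a frame `α` translating the chart): the input of the chosen
orientation's map at the SERVED near sign, realised at `c`, from the family of `AtQNQ` — the frame is a hypothesis (U_s: `c` = the proxy of an arbitrary vertex, `α` its exact
coarse frame). [cite: KozmaNitzan2024, §4 pp. 19–21 ((21)–(25))] -/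
theorem inputsAt_of_atQNQ_frame {κ : Consts} {Φ : PlanarSkeletonFrmQuasi G} {t : V} {p : unitInterval} {hC : Φ.CylSubcritical p} {O : OutNS V} {q : unitInterval}
    (𝒞 : ChoiceNQ κ Φ t p hC) (hAt : 𝒞.AtQNQ O q) {c : V} {α : G ≃g G} (hαt : α t = c)
    (hφ : ∀ w, PlanarSkeletonFrmQuasi.φ Φ (α w) = PlanarSkeletonFrmQuasi.φ Φ w + (PlanarSkeletonFrmQuasi.φ Φ c - PlanarSkeletonFrmQuasi.φ Φ t))
    {M n : ℕ} (hMn : (M, n) ∈ 𝒞.SMn O) (fam : Fin 2) (τ : ℤˣ) :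
    1 - 𝒞.δI < (bondPercolation G q).real
      (eventNAt G (oriφ Φ.φ (O.ori t M n)) O.merged.toDataN t c (M, some (n, fam, Skelφ.StepI.sgQ O.qd O.qdT O.ori t M n fam, τ))) := by
  obtain ⟨hfacts, -, -, hin, -⟩ := hAt
  obtain ⟨-, -, -, -, hΛ, e1, e2, e3, -, -, -⟩ := hfacts.1
  simp only [Skelφ.StepI.OutNS.toOutO_D, Skelφ.StepI.OutNS.toOutO_DT] at hΛ e1 e2 e3
  have ht : t ∈ ({t} : Finset V) := Finset.mem_singleton_self t
  have h := hin _ (Skelφ.StepI.mem_indexNQ_some ht hMn fam τ)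
  rw [Skelφ.StepI.eventO_some_eq_eventN_orient Φ.φ e1 e2 e3] at h
  rw [Skelφ.StepI.OutNS.merged_toDataN,
    Skelφ.StepI.real_eventNAt_frame₂ hαt hφ Φ.frame hC q (D := O.D.toDataN.orient O.DT.toDataN O.ori) hΛ (O.ori t M n)]
  exact h

-- GEN-Q (R-2, captain 2026-08-27): `PlanarSkeletonFrmFrom.ChoiceNQ.inputsAt_one_of_atQNQ_frame` is not in the used cone of the node top — not ported.

-- GEN-Q (R-2, captain 2026-08-27): `PlanarSkeletonFrmFrom.ChoiceNQ.inputsSelAt_of_atQNQ_frame` is not in the used cone of the node top — not ported.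

-- GEN-Q (R-2, captain 2026-08-27): `PlanarSkeletonFrmFrom.ChoiceNQ.zoneAt_of_atQNQ_frame` is not in the used cone of the node top — not ported.

end ChoiceNQ

end PlanarSkeletonFrmQuasi

end Summit.CriticalPhenomena.PercolationContinuityZ3.Theorems.Transplant

end
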